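import Mathlib
import Summits.Parity.GeneralizedHardyLittlewood.Theorems.FordMaynardSieveConst01651SieveConst01651ShellSeparation
import Summits.Parity.GeneralizedHardyLittlewood.Theorems.FordMaynardSieveConst01651SieveConst01651ShellSeparationMany

/-!
# Route `FordMaynardSieveConst01651`, target `SieveConst01651` (stmt-Parity-19185), line `sieve_decomposition`:
# helpers towards `stub_typeIIRegion` — Ford–Maynard Lemma 7.11 WITH the (w)-controlled shells: many flagged
# real-exponent conditions on a kernel bounded below

`…ShellSeparation.bilin_threshold_of_neg_le` is Lemma 7.10 for ONE strict condition on a real kernel `k ≥ -M`;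
`…ShellSeparationMany.bilin_thresholds_shell(_flag)` iterates the generic (no lower bound) version.  The workhorse the
assembly of Proposition 7.19 actually needs is the iteration of the LOWER-BOUND version over a list of flagged
(strict / non-strict) conditions — the faces of the polytope cells, the smoothness conditions `block ≤ n^ν`,
`P⁺(v) < n^ν`, the roughness conditions `p > n^ν` — with every shell paid in the currency
`2 ∑_{|Aᵢ z - Bᵢ w| ≤ 3/R} M` (then `M = τ-weight · x^{ν/10}` and the lattice-point counts):

* `prod_realIndicator_mem_unitInterval` — a product of real `0/1` indicators lies in `[0, 1]`;
* `bilin_threshold_flag_of_neg_le` — one flagged condition: bound `(3(1 + log R) + 4) X + 2 ∑_shell M`;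
* `bilin_thresholds_flag_of_neg_le` — `r` flagged conditions:
  `(3(1 + log R) + 4)^r · (X + 2 ∑ᵢ ∑_{|Aᵢ z - Bᵢ w| ≤ 3/R} M w z)`.

Def-free. Nothing here proves anything about the Parity summit; helpers for the Type-II region stub of one leaf.
-/

noncomputable section

open Real Finset
open Literature.NumberTheory.Sieve.FriedlanderIwaniecPrimes

namespace Summit.Parity.GeneralizedHardyLittlewood.FordMaynardSieveConst01651SieveConst01651

variable {ι κ : Type*}

/-- A product of real `0/1` indicators lies in `[0, 1]`. [folklore] -/
theorem prod_realIndicator_mem_unitInterval (l : List ((κ → ℝ) × (ι → ℝ) × Bool)) (w : ι) (z : κ) :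
    0 ≤ (l.map fun p => if (if p.2.2 then p.2.1 w < p.1 z else p.2.1 w ≤ p.1 z) then (1 : ℝ) else 0).prod ∧
      (l.map fun p => if (if p.2.2 then p.2.1 w < p.1 z else p.2.1 w ≤ p.1 z) then (1 : ℝ) else 0).prod ≤ 1 := by
  induction l with
  | nil => simp
  | cons p l ih =>
    simp only [List.map_cons, List.prod_cons]
    constructor
    · exact mul_nonneg (by split_ifs <;> norm_num) ih.1
    · exact mul_le_one₀ (by split_ifs <;> norm_num) ih.1 ih.2

/-- The complex product of flagged indicators is the cast of the real one. [folklore] -/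
theorem prod_flagIndicator_eq_ofReal (l : List ((κ → ℝ) × (ι → ℝ) × Bool)) (w : ι) (z : κ) :
    (l.map fun p => if (if p.2.2 then p.2.1 w < p.1 z else p.2.1 w ≤ p.1 z) then (1 : ℂ) else 0).prod =
      (((l.map fun p => if (if p.2.2 then p.2.1 w < p.1 z else p.2.1 w ≤ p.1 z) then (1 : ℝ) else 0).prod : ℝ)
        : ℂ) := by
  induction l with
  | nil => simp
  | cons p l ih =>
    simp only [List.map_cons, List.prod_cons, Complex.ofReal_mul, ih]
    congr 1
    split_ifs <;> simp

/-- **One flagged condition on a kernel bounded below** (Lemma 7.10, strict or non-strict): for a real kernel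
`k ≥ -M` (`M ≥ 0`) with `BilinBoundedBy k W Z X` and `|A z - B w| ≤ R` (`R ≥ 1`), the kernel
`[B w < A z] · k` resp. `[B w ≤ A z] · k` is `BilinBoundedBy` with bound
`(3(1 + log R) + 4) X + 2 ∑_{|A z - B w| ≤ 3/R} M w z`. [cite: FordMaynard2024PrimeSieves, Lemma 7.10] -/
theorem bilin_threshold_flag_of_neg_le {k M : ι → κ → ℝ} {W : Finset ι} {Z : Finset κ} {X : ℝ}
    (h : BilinBoundedBy (fun w z => (k w z : ℂ)) W Z X)
    (hM0 : ∀ w ∈ W, ∀ z ∈ Z, 0 ≤ M w z) (hkM : ∀ w ∈ W, ∀ z ∈ Z, -M w z ≤ k w z)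
    {A : κ → ℝ} {B : ι → ℝ} (strict : Bool) {R : ℝ} (hR : 1 ≤ R)
    (hsize : ∀ w ∈ W, ∀ z ∈ Z, |A z - B w| ≤ R) :
    BilinBoundedBy (fun w z => (if (if strict then B w < A z else B w ≤ A z) then (1 : ℂ) else 0) * (k w z : ℂ))
      W Z ((3 * (1 + Real.log R) + 4) * X +
        2 * ∑ w ∈ W, ∑ z ∈ Z, if |A z - B w| ≤ 3 / R then M w z else 0) := by
  have hX0 : 0 ≤ X := h.nonneg
  cases strict with
  | true =>
    refine ((bilin_threshold_of_neg_le h hM0 hkM hR hsize).mono (by nlinarith)).congr fun w _ z _ => ?_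
    simp
  | false =>
    -- `[B ≤ A] k = k - [-B < -A] k`
    have hsize' : ∀ w ∈ W, ∀ z ∈ Z, |(-A z) - (-B w)| ≤ R := fun w hw z hz => by
      rw [show (-A z) - (-B w) = -(A z - B w) by ring, abs_neg]; exact hsize w hw z hz
    have h1 := bilin_threshold_of_neg_le h hM0 hkM (A := fun z => -A z) (B := fun w => -B w) hR hsize'
    have h2 := (h1.const_mul (-1)).mono (le_of_eq (by rw [norm_neg, norm_one, one_mul]))
    have h3 := h.add h2
    have hshell : ∀ w z, (if |(-A z) - (-B w)| ≤ 3 / R then M w z else 0) =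
        if |A z - B w| ≤ 3 / R then M w z else 0 := fun w z => by
      rw [show (-A z) - (-B w) = -(A z - B w) by ring, abs_neg]
    simp only [hshell] at h3
    refine (h3.mono (le_of_eq (by ring))).congr fun w _ z _ => ?_
    by_cases hle : B w ≤ A z
    · have : ¬ (-B w < -A z) := not_lt.mpr (by linarith)
      simp [hle, this]
    · have : -B w < -A z := by linarith [not_le.mp hle]
      simp [hle, this]

/-- **Ford–Maynard Lemma 7.11 with the (w)-controlled shells.** Let `k ≥ -M` (`M ≥ 0`) be a real kernel with
`BilinBoundedBy k W Z X`, and let `(Aᵢ, Bᵢ, strictᵢ)`, `i < r`, be flagged conditions with `|Aᵢ z - Bᵢ w| ≤ R`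
(`R ≥ 1`). Then `(∏ᵢ [Bᵢ w < Aᵢ z / Bᵢ w ≤ Aᵢ z]) · k` is `BilinBoundedBy` with bound
`(3(1 + log R) + 4)^r · (X + 2 ∑ᵢ ∑_{|Aᵢ z - Bᵢ w| ≤ 3/R} M w z)`.
[cite: FordMaynard2024PrimeSieves, Lemma 7.11] -/
theorem bilin_thresholds_flag_of_neg_le {k M : ι → κ → ℝ} {W : Finset ι} {Z : Finset κ} {X : ℝ}
    (h : BilinBoundedBy (fun w z => (k w z : ℂ)) W Z X)
    (hM0 : ∀ w ∈ W, ∀ z ∈ Z, 0 ≤ M w z) (hkM : ∀ w ∈ W, ∀ z ∈ Z, -M w z ≤ k w z) {R : ℝ} (hR : 1 ≤ R) :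
    ∀ l : List ((κ → ℝ) × (ι → ℝ) × Bool), (∀ p ∈ l, ∀ w ∈ W, ∀ z ∈ Z, |p.1 z - p.2.1 w| ≤ R) →
      BilinBoundedBy (fun w z =>
        (l.map fun p => if (if p.2.2 then p.2.1 w < p.1 z else p.2.1 w ≤ p.1 z) then (1 : ℂ) else 0).prod *
          (k w z : ℂ)) W Z
        ((3 * (1 + Real.log R) + 4) ^ l.length *
          (X + 2 * (l.map fun p => ∑ w ∈ W, ∑ z ∈ Z,
            if |p.1 z - p.2.1 w| ≤ 3 / R then M w z else 0).sum)) := by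
  have hX0 : 0 ≤ X := h.nonneg
  have hc1 : 1 ≤ 3 * (1 + Real.log R) + 4 := by
    have := Real.log_nonneg hR; linarith
  intro l
  induction l with
  | nil =>
    intro _
    refine (h.mono (le_of_eq ?_)).congr fun w _ z _ => ?_
    · simp
    · simp
  | cons p l ih =>
    intro hl
    have ih' := ih fun q hq => hl q (List.mem_cons_of_mem p hq)
    have hp := hl p (List.mem_cons_self)
    -- the kernel after the conditions of `l`, as a REAL kernel bounded below by `-M`
    set k' : ι → κ → ℝ := fun w z =>
      (l.map fun q => if (if q.2.2 then q.2.1 w < q.1 z else q.2.1 w ≤ q.1 z) then (1 : ℝ) else 0).prod * k w z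
      with hk'
    have ihR : BilinBoundedBy (fun w z => (k' w z : ℂ)) W Z
        ((3 * (1 + Real.log R) + 4) ^ l.length *
          (X + 2 * (l.map fun q => ∑ w ∈ W, ∑ z ∈ Z,
            if |q.1 z - q.2.1 w| ≤ 3 / R then M w z else 0).sum)) := by
      refine ih'.congr fun w _ z _ => ?_
      rw [hk']; simp only
      rw [Complex.ofReal_mul, prod_flagIndicator_eq_ofReal]
    have hk'M : ∀ w ∈ W, ∀ z ∈ Z, -M w z ≤ k' w z := by
      intro w hw z hz
      obtain ⟨hP0, hP1⟩ := prod_realIndicator_mem_unitInterval l w z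
      have hMwz := hM0 w hw z hz
      have hkwz := hkM w hw z hz
      rw [hk']; simp only
      rcases le_or_gt 0 (k w z) with hk0 | hk0
      · nlinarith [mul_nonneg hP0 hk0]
      · -- `P k ≥ k ≥ -M` as `0 ≤ P ≤ 1`, `k < 0`
        nlinarith
    -- one more condition
    have h1 := bilin_threshold_flag_of_neg_le ihR hM0 hk'M (A := p.1) (B := p.2.1) p.2.2 hR hp
    -- nonnegativity of the shell sums
    have hS0 : ∀ q : (κ → ℝ) × (ι → ℝ) × Bool,
        0 ≤ ∑ w ∈ W, ∑ z ∈ Z, (if |q.1 z - q.2.1 w| ≤ 3 / R then M w z else 0 : ℝ) := fun q =>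
      sum_nonneg fun w hw => sum_nonneg fun z hz => by
        split_ifs
        · exact hM0 w hw z hz
        · exact le_rfl
    have hL0 : 0 ≤ (l.map fun q => ∑ w ∈ W, ∑ z ∈ Z,
        (if |q.1 z - q.2.1 w| ≤ 3 / R then M w z else 0 : ℝ)).sum :=
      List.sum_nonneg (by
        intro a ha
        obtain ⟨q, _, rfl⟩ := List.mem_map.mp ha
        exact hS0 q)
    refine (h1.mono ?_).congr fun w _ z _ => ?_
    · simp only [List.map_cons, List.sum_cons, List.length_cons, pow_succ]
      set c : ℝ := 3 * (1 + Real.log R) + 4 with hc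
      set n : ℕ := l.length
      set Sl : ℝ := (l.map fun q => ∑ w ∈ W, ∑ z ∈ Z,
        (if |q.1 z - q.2.1 w| ≤ 3 / R then M w z else 0 : ℝ)).sum
      set Sp : ℝ := ∑ w ∈ W, ∑ z ∈ Z, (if |p.1 z - p.2.1 w| ≤ 3 / R then M w z else 0 : ℝ)
      have hcn1 : 1 ≤ c ^ n * c := by
        calc (1 : ℝ) = 1 * 1 := by ring
          _ ≤ c ^ n * c := mul_le_mul (one_le_pow₀ hc1) hc1 zero_le_one (by positivity)
      have hSp0 : 0 ≤ Sp := hS0 p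
      calc c * (c ^ n * (X + 2 * Sl)) + 2 * Sp ≤ c * (c ^ n * (X + 2 * Sl)) + c ^ n * c * (2 * Sp) := by
            nlinarith
        _ = c ^ n * c * (X + 2 * (Sp + Sl)) := by ring
    · rw [hk']; simp only
      rw [List.map_cons, List.prod_cons, Complex.ofReal_mul, prod_flagIndicator_eq_ofReal]
      ring

end Summit.Parity.GeneralizedHardyLittlewood.FordMaynardSieveConst01651SieveConst01651
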